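import Literature.MathematicalPhysics.QuantumFieldTheory.Balaban1983to89.B7ConclKExp

/-!
# `Balaban1983to89.B7Prop6FirstClause` — T. Bałaban, *Averaging operations for lattice gauge theories*, Commun. Math. Phys.
**98** (1985) 17–51 [Balaban1985Averaging]: **the FIRST CLAUSE of Proposition 6 (p. 43) — «`\overline{U′U₀}ᵏ` is an analytic function
of `A′`» — AS A TYPED DECL OF RECORD over the abstract `k`-fold carrier, and its MODEL INSTANCE on the concrete `ℤᵈ` objects**

statement-level skeleton of published theorems with citation tags; proofs where landed; nothing here is a claim about the Yang–Mills mass gap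

CITATION HEADER (lean-in-tree rule).  Cell `lit-balaban`, unit `lit-balaban-r04` (owner of block B7 = CMP 98), gen 10; SKELETON row
**`B7.Prop6`** (Prop. 6 (164) p. 43 [PDF 27]; held text `paper:balaban1985-cmp98-averaging`, journal page = PDF page + 16).  WHY THIS FILE:
the decl of record `B7.Prop6Printed` (`B7.lean`) types only the SECOND clause of Proposition 6, the bound (164); the FIRST clause — the
analyticity of the average `\overline{U′U₀}ᵏ` in `A′` — has no field in the carrier `B7.KExp` (second-reader note F6/F7 on row B7.Prop6,
`lit-balaban-r07/SECOND-READ-B7.md` §2: «a carrier predicate `IsAnalyticAvg U₀ α₁` + a conjunct in a superseding decl would be the fix»).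
`B7.lean` has one writer (the typer), so the superseding decl lives HERE, over a carrier `KExpA` EXTENDING `B7.KExp` by that one predicate.
The kernel theorems already in the tree: @flat `B7Prop6Flat.prop6_flat_analyticAt` (p22), @gen `B7Prop6GeneralAnalytic.prop6_general_analyticAt`
/ `prop6_general_analyticOnNhd_ins` / `avgIter_eq_avgQG` (r04 gen 3, p247553); the `B7.KExp` model instance `B7ConclKExp.concreteKExp` with
`prop6Printed_K` ((164)) is r04 gen 6 (p258997).

PRINT (verbatim, p. 43 [PDF 27] ll. 2–6; p. 42 last lines for the proof sentence).  «Proposition 6. If `U₀` satisfies (52), then `\overline{U′U₀}ᵏ`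
is an analytic function of `A′ = (1/(iη)) log U′` for `A′` with values in the complexified algebra, and satisfying `|A′| < α₁`. Moreover, we
have a bound `|\overline{U′U₀}ᵏ(Ū₀ᵏ)⁻¹ − 1| < O(1)α₁`. (164)  Of course, we assume that `α₀, α₁` are sufficiently small.»  Proof sentence
(p. 42, after (163)): «Moreover, Proposition 4 implies that the functions of `A` in (159) are analytic. We get the following [Proposition 6]».

WHAT THIS MODULE STATES AND PROVES (all in full; no `sorry`, no `Prop`-valued constant without a proof).
* §1 `KExpA` — the carrier `B7.KExp` extended by ONE predicate `IsAnalyticAvg : Cfg → ℝ → Prop` («`\overline{U′U₀}ᵏ` is an analytic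
  function of `A′` on `|A′| < r`»); `Prop6AnalyticPrinted fam` — the FIRST clause typed in the shape of `B7.Prop6Printed` (threshold `c`
  chosen before the instance; `plaqDevEta U₀ < α₀ ≤ c`, `0 < α₁ ≤ c`); `Prop6PrintedFull fam` — BOTH clauses under ONE threshold (print:
  «we assume that α₀, α₁ are sufficiently small» once), the (164) member being `B7.Prop6Printed`'s verbatim; the projections
  `Prop6PrintedFull.analytic`, `Prop6PrintedFull.toProp6Printed` (onto the decl of record over `toKExp`), the converse `prop6PrintedFull_of`
  and `prop6PrintedFull_iff`.
* §2 `concreteKExpA 𝔸 G L` — gen 6's `concreteKExp 𝔸 G L` (index `KIdx` = (`k`; bond `c = ⟨z, z+e_κ⟩` of `Ω^{(k)}`; fine bond `b`)) with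
  `IsAnalyticAvg U₀ r := ∀` finite sets `S` of fine bonds, `(A′_b)_{b∈S} ↦ \overline{U′U₀}ᵏ(c)` (`U′ = e^{ηA′}` inserted on `S`, `= 1` off `S`;
  `\overline{·}ᵏ = B7Prop2Explicit.avgIter`, the GENUINE `k`-fold average (43)) is analytic on a neighbourhood of every point of the open
  polydisc `{∀ b ∈ S, ‖A′_b‖ < r}` — the same finite-bond-family reading of «analytic function of `A′`» as the carrier's `IsAnalyticQk` /
  `IsJointlyAnalytic` (gen 6); `concreteKExpA_toKExp` (`rfl`).
* §3 **`prop6AnalyticPrinted_K`** (`L ≥ 2`, `G` average-closed): the first clause HOLDS for `concreteKExpA 𝔸 G L` with `c = B7ConclKExp.cK d L`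
  — kernel `B7Prop6GeneralAnalytic.prop6_general_analyticAt` along the analytic coordinates `a ↦ η·insCfg S a` plus the identification
  `avgIter_eq_avgQG` on the open polydisc (`B7Prop4Flat.isOpen_polydisc`), the regime lemmas of `B7ConclKExp`; `prop6Printed_KA` (= gen 6's
  `prop6Printed_K` transported along `toKExp`); **`prop6PrintedFull_K : Prop6PrintedFull (concreteKExpA 𝔸 G L)`** — Proposition 6 WITH BOTH
  CLAUSES inhabited on the concrete carrier.

HONEST SCOPE.  (i) «analytic function of `A′`» is read, as everywhere in the B7 carriers, as analyticity in every FINITE family of bond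
variables `(A′_b)_{b∈S}` on the open sup-norm polydisc of radius `α₁` (the printed `A′` ranges over all bounded `𝔤ᶜ`-valued fields;
`U′ = 1` off `S`); (ii) `𝔸` a complete normed `ℂ`-algebra with `‖1‖ = 1`, `G ≤ 𝔸ˣ` an average-closed subgroup (`B7Prop2Explicit.AvgClosed`;
`U(N)`-type instances are other files'), `U₀` `G`-valued with (52) decoded from `plaqDevEta` exactly as in `B7ConclKExp` (guard `grpDefect`);
(iii) ONE threshold `c = cK d L` for `α₀` and `α₁` («sufficiently small»; depends on `d` and `L`), `L ≥ 2`; (iv) the abstract statements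
`Prop6AnalyticPrinted` / `Prop6PrintedFull` are as weak or strong as the carrier predicate a family puts in `IsAnalyticAvg` — the content is
the model instance §3, as for every `…Printed` decl of `B7.lean`; (v) `B7.lean`, `B7.Prop6Printed` and `B7ConclKExp` are untouched and keep
their meaning; nothing here is cited by `B7.Concl`.  No new `Prop` fact; axioms standard.
v1.1 (unit `lit-balaban-r04` gen 22, DOCSTRING-ONLY; every declaration byte-identical with v1.0 p313664): the locator of (43) corrected
from "p.25" to p. 24 in one `[cite:]` tag (own-stem locator audit of the `[cite: Balaban1985Averaging, …]` tags against a display→page map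
of CMP 98 built from the held text layer `paper:balaban1985-cmp98-averaging` and verified on the ×2 renders
`…/1985-cmp98-averaging-p0NN-x2.png`: (43)–(45) stand on p. 24 (render p008), (46)–(50) on p. 25).
-/

noncomputable section

open scoped BigOperators
open NormedSpace

namespace Literature.MathematicalPhysics.QuantumFieldTheory.Balaban1983to89.B7Prop6FirstClause

open B7Prop1Explicit B7Prop2Explicit B7Prop3Flat B7ConclKExp B7Prop6GeneralAnalytic

-- `Site` alone would resolve to the torus sites of `Setup.lean`; re-export the `ℤ^d` sites of `B7Prop1Explicit`.
export B7Prop1Explicit (Site)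

variable {d : ℕ}

/-! ## §1 The extended carrier and the typed statements -/

/-- **The `k`-fold carrier of `B7.lean` extended by the predicate of Proposition 6's first clause**: all fields of `B7.KExp` (configurations
`U₀`, fields `A′`, `plaqDevEta` = the (52) functional, `fldNorm = |A′|`, …) plus `IsAnalyticAvg U₀ r` = «`\overline{U′U₀}ᵏ` is an analytic
function of `A′ = (1/(iη)) log U′` for `A′` with values in the complexified algebra, and satisfying `|A′| < r`».
[cite: Balaban1985Averaging, Proposition 6 p.43] -/
structure KExpA extends B7.KExp where
  /-- «`\overline{U′U₀}ᵏ` is an analytic function of `A′`» on `|A′| < r` -/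
  IsAnalyticAvg : Cfg → ℝ → Prop

/-- **Proposition 6, FIRST CLAUSE** (p. 43 [PDF 27], verbatim): *"If `U₀` satisfies (52), then `\overline{U′U₀}ᵏ` is an analytic function of
`A′ = (1/(iη)) log U′` for `A′` with values in the complexified algebra, and satisfying `|A′| < α₁`. … Of course, we assume that `α₀, α₁` are
sufficiently small."*  Typed in the shape of the decl of record `B7.Prop6Printed` (threshold `c` before the instance; (52) as
`plaqDevEta U₀ < α₀`). [cite: Balaban1985Averaging, Proposition 6 p.43] -/
def Prop6AnalyticPrinted {I : Type} (fam : I → KExpA) : Prop :=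
  ∃ c : ℝ, 0 < c ∧
    ∀ i : I, ∀ α₀ α₁ : ℝ, 0 < α₀ → α₀ ≤ c → 0 < α₁ → α₁ ≤ c → ∀ U₀ : (fam i).Cfg,
      (fam i).plaqDevEta U₀ < α₀ → (fam i).IsAnalyticAvg U₀ α₁

/-- **Proposition 6, BOTH CLAUSES under one threshold** (p. 43 [PDF 27], verbatim): *"If `U₀` satisfies (52), then `\overline{U′U₀}ᵏ` is an
analytic function of `A′ = (1/(iη)) log U′` for `A′` with values in the complexified algebra, and satisfying `|A′| < α₁`. Moreover, we have a
bound `|\overline{U′U₀}ᵏ(Ū₀ᵏ)⁻¹ − 1| < O(1)α₁`. (164)  Of course, we assume that `α₀, α₁` are sufficiently small."* — the superseding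
conjunction asked for by the second reader (row B7.Prop6, note F6/F7); its (164) member is `B7.Prop6Printed`'s text
(`Prop6PrintedFull.toProp6Printed`). [cite: Balaban1985Averaging, Proposition 6 (164) p.43] -/
def Prop6PrintedFull {I : Type} (fam : I → KExpA) : Prop :=
  ∃ O₁ c : ℝ, 0 < O₁ ∧ 0 < c ∧
    ∀ i : I, ∀ α₀ α₁ : ℝ, 0 < α₀ → α₀ ≤ c → 0 < α₁ → α₁ ≤ c → ∀ U₀ : (fam i).Cfg,
      (fam i).plaqDevEta U₀ < α₀ →
        (fam i).IsAnalyticAvg U₀ α₁ ∧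
        ∀ A' : (fam i).Fld, (fam i).fldNorm A' < α₁ → (fam i).avgRatioDev U₀ A' < O₁ * α₁

/-- the full statement gives the first clause. [cite: Balaban1985Averaging, Proposition 6 p.43] -/
theorem Prop6PrintedFull.analytic {I : Type} {fam : I → KExpA} (h : Prop6PrintedFull fam) :
    Prop6AnalyticPrinted fam := by
  obtain ⟨_, c, _, hc, H⟩ := h
  exact ⟨c, hc, fun i α₀ α₁ h₁ h₂ h₃ h₄ U₀ hU => (H i α₀ α₁ h₁ h₂ h₃ h₄ U₀ hU).1⟩

/-- the full statement gives the decl of record `B7.Prop6Printed` ((164)) for the underlying `B7.KExp` family.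
[cite: Balaban1985Averaging, Proposition 6 (164) p.43] -/
theorem Prop6PrintedFull.toProp6Printed {I : Type} {fam : I → KExpA} (h : Prop6PrintedFull fam) :
    B7.Prop6Printed (fun i => (fam i).toKExp) := by
  obtain ⟨O₁, c, hO, hc, H⟩ := h
  exact ⟨O₁, c, hO, hc, fun i α₀ α₁ h₁ h₂ h₃ h₄ U₀ hU A' hA' => (H i α₀ α₁ h₁ h₂ h₃ h₄ U₀ hU).2 A' hA'⟩

/-- conversely, the first clause and `B7.Prop6Printed` (each with its own threshold) give the full statement at the smaller threshold.
[cite: Balaban1985Averaging, Proposition 6 (164) p.43] -/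
theorem prop6PrintedFull_of {I : Type} {fam : I → KExpA} (h₁ : Prop6AnalyticPrinted fam)
    (h₂ : B7.Prop6Printed (fun i => (fam i).toKExp)) : Prop6PrintedFull fam := by
  obtain ⟨c₁, hc₁, H₁⟩ := h₁
  obtain ⟨O₁, c₂, hO, hc₂, H₂⟩ := h₂
  refine ⟨O₁, min c₁ c₂, hO, lt_min hc₁ hc₂, fun i α₀ α₁ hα₀ hα₀c hα₁ hα₁c U₀ hU => ⟨?_, fun A' hA' => ?_⟩⟩
  · exact H₁ i α₀ α₁ hα₀ (hα₀c.trans (min_le_left _ _)) hα₁ (hα₁c.trans (min_le_left _ _)) U₀ hU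
  · exact H₂ i α₀ α₁ hα₀ (hα₀c.trans (min_le_right _ _)) hα₁ (hα₁c.trans (min_le_right _ _)) U₀ hU A' hA'

/-- `Prop6PrintedFull` = first clause ∧ `B7.Prop6Printed`. [cite: Balaban1985Averaging, Proposition 6 (164) p.43] -/
theorem prop6PrintedFull_iff {I : Type} (fam : I → KExpA) :
    Prop6PrintedFull fam ↔ Prop6AnalyticPrinted fam ∧ B7.Prop6Printed (fun i => (fam i).toKExp) :=
  ⟨fun h => ⟨h.analytic, h.toProp6Printed⟩, fun h => prop6PrintedFull_of h.1 h.2⟩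

/-! ## §2 The concrete carrier -/

section Carrier

variable (𝔸 : Type) [NormedRing 𝔸] [NormOneClass 𝔸] [NormedAlgebra ℂ 𝔸] [CompleteSpace 𝔸] (G : Subgroup 𝔸ˣ)

/-- **The concrete `k`-fold family with the Prop.-6 analyticity predicate**: `B7ConclKExp.concreteKExp 𝔸 G L` (all configurations on `ℤᵈ`
with the `G`-guard inside `plaqDevEta`, bounded fields `A′`, `U′ = e^{ηA′}`, …) and `IsAnalyticAvg U₀ r :=` for every finite set `S` of fine
bonds, `(A′_b)_{b∈S} ↦ \overline{U′U₀}ᵏ(c)` — `U′ = e^{ηA′}` inserted on `S` (`B7Prop3Flat.insCfg`, `η = L^{-k}`), `\overline{·}ᵏ` the genuine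
`k`-fold average `avgIter` (43), read at the index bond `c = ⟨z, z + e_κ⟩` of `Ω^{(k)}` — is analytic on a neighbourhood of every point of the
open polydisc `{∀ b ∈ S, ‖A′_b‖ < r}`. [cite: Balaban1985Averaging, Proposition 6 p.43, (43) p.24, (158) p.42] -/
def concreteKExpA (L : ℕ) (i : KIdx d) : KExpA where
  toKExp := concreteKExp 𝔸 G L i
  IsAnalyticAvg := fun (U₀ : Site d → Fin d → 𝔸ˣ) (r : ℝ) => ∀ S : Finset (Site d × Fin d),
    AnalyticOnNhd ℂ
      (fun a : S → 𝔸 => ((avgIter L (expCfg (((L : ℝ) ^ i.k)⁻¹ • insCfg S a) * U₀) i.k i.z i.κ : 𝔸ˣ) : 𝔸))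
      {a | ∀ s, ‖a s‖ < r}

omit [NormOneClass 𝔸] in
/-- the underlying `B7.KExp` family is gen 6's `concreteKExp`. [cite: Balaban1985Averaging, Proposition 6 p.43] -/
theorem concreteKExpA_toKExp (L : ℕ) (i : KIdx d) : (concreteKExpA 𝔸 G L i).toKExp = concreteKExp 𝔸 G L i := rfl

end Carrier

/-! ## §3 Proposition 6, both clauses, for the concrete family -/

section Props

variable {𝔸 : Type} [NormedRing 𝔸] [NormOneClass 𝔸] [NormedAlgebra ℂ 𝔸] [CompleteSpace 𝔸] {G : Subgroup 𝔸ˣ}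

/-- **Proposition 6, FIRST CLAUSE, for `concreteKExpA 𝔸 G L`** (`L ≥ 2`, `G` average-closed): witness `c = cK d L`.  For `U₀` with
`plaqDevEta U₀ < α₀ ≤ c` (`G`-valued with (52): `regime_of_dev_lt`) and `0 < α₁ ≤ c`, every finite bond family `S` and every point `a` of the
polydisc `{‖a_b‖ < α₁}`: the composite (159) `t ↦ w_k(c₋)e^{Q_k(U₀, η·insCfg S t)(c)}Ū₀ᵏ(c)w_k(c₊)⁻¹` is analytic at `a`
(`B7Prop6GeneralAnalytic.prop6_general_analyticAt`, coordinates analytic by `B7ConclKExp.ins_data`, smallness from `exp_regime` /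
`field_regime` at `|η·insCfg S a| ≤ η‖a‖`), and on the (open) polydisc it coincides with `\overline{U′U₀}ᵏ(c)` (`avgIter_eq_avgQG`) — «Proposition 4
implies that the functions of `A` in (159) are analytic». [cite: Balaban1985Averaging, Proposition 6 p.43, (159) p.42] -/
theorem prop6AnalyticPrinted_K (L : ℕ) (hL : 2 ≤ L) (hG : AvgClosed d L G) :
    Prop6AnalyticPrinted (concreteKExpA 𝔸 G (d := d) L) := by
  have hL1 : 1 ≤ L := le_trans (by norm_num) hL
  refine ⟨cK d L, cK_pos d hL1, ?_⟩
  rintro ⟨k, z, κ, y, μ⟩ α₀ α₁ hα₀ hα₀c hα₁ hα₁c U₀ hdev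
  dsimp only [concreteKExpA, concreteKExp] at U₀ hdev ⊢
  obtain ⟨hC0, -, hα4, -, -, -, -, hα1⟩ := alpha_regime (d := d) hL1 hα₀ hα₀c
  obtain ⟨hU₀, h52⟩ := regime_of_dev_lt hL1 hdev hα1
  intro S
  -- the data of the kernels at a point of the polydisc of radius `α₁`
  have hpt : ∀ a : S → 𝔸, ‖a‖ < α₁ →
      (∀ (x : Site d) (κ' : Fin d), ‖(((L : ℝ) ^ k)⁻¹ • insCfg S a) x κ'‖ ≤ ((L : ℝ) ^ k)⁻¹ * ‖a‖) ∧
      (∀ (x : Site d) (κ' : Fin d), AnalyticAt ℂ (fun t : S → 𝔸 => (((L : ℝ) ^ k)⁻¹ • insCfg S t) x κ') a) ∧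
      Real.exp (4 * (800 * ((d : ℝ) + 1) ^ 2 * ((d : ℝ) + 4)) * α₀)
          * (1 + 8 * (131072 * ((d : ℝ) + 1) ^ 2) * ((L : ℝ) ^ k * (((L : ℝ) ^ k)⁻¹ * ‖a‖))) ≤ 2 ∧
      2 * ((L : ℝ) ^ k * (((L : ℝ) ^ k)⁻¹ * ‖a‖)) ≤ c3 d L := by
    intro a hna
    obtain ⟨hB, hBa⟩ := ins_data L k hL1 S a
    have hsc := (scaling_data L k hL1 (insCfg S a) (fun x κ' => norm_insCfg_le S a x κ')).2
    obtain ⟨hs, -, -, -⟩ := exp_regime (d := d) hL1 hα₀ hα₀c (norm_nonneg a) (hna.le.trans hα₁c) (norm_nonneg a)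
      (hna.le.trans hα₁c)
    obtain ⟨-, -, hc3, -⟩ := field_regime (d := d) hL1 (hna.le.trans hα₁c)
    rw [← hsc] at hs hc3
    exact ⟨hB, hBa, hs, hc3⟩
  -- the composite (159) is analytic on the polydisc
  have hmodel : AnalyticOnNhd ℂ
      (fun a : S → 𝔸 => avgQG L U₀ (((L : ℝ) ^ k)⁻¹ • insCfg S a) k z κ) {a | ∀ s, ‖a s‖ < α₁} := by
    intro a ha
    have hna : ‖a‖ < α₁ := (pi_norm_lt_iff hα₁).2 ha
    obtain ⟨hB, hBa, hs, hc3⟩ := hpt a hna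
    exact prop6_general_analyticAt L hL hG k U₀ hU₀ hα₀ hC0 hα4 h52
      (fun t : S → 𝔸 => ((L : ℝ) ^ k)⁻¹ • insCfg S t) hBa (by positivity) hB hs hc3 z κ
  -- and coincides there with the genuine average `\overline{U′U₀}ᵏ(c)`
  refine hmodel.congr (B7Prop4Flat.isOpen_polydisc S _) fun a ha => ?_
  have hna : ‖a‖ < α₁ := (pi_norm_lt_iff hα₁).2 ha
  obtain ⟨hB, -, hs, hc3⟩ := hpt a hna
  exact (avgIter_eq_avgQG L hL hG k U₀ hU₀ hα₀ hC0 hα4 h52 (((L : ℝ) ^ k)⁻¹ • insCfg S a) (by positivity)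
    hB hs hc3 z κ).symm

/-- **Proposition 6 (164) (`B7.Prop6Printed`) for the underlying `B7.KExp` family of `concreteKExpA 𝔸 G L`** = gen 6's
`B7ConclKExp.prop6Printed_K` (O(1) = 200(d+1), `c = cK d L`) read through `toKExp`. [cite: Balaban1985Averaging, Proposition 6 (164) p.43] -/
theorem prop6Printed_KA (L : ℕ) (hL : 2 ≤ L) (hG : AvgClosed d L G) :
    B7.Prop6Printed (fun i => (concreteKExpA 𝔸 G (d := d) L i).toKExp) :=
  prop6Printed_K (𝔸 := 𝔸) (G := G) L hL hG

/-- **PROPOSITION 6 WITH BOTH CLAUSES for `concreteKExpA 𝔸 G L`** (`L ≥ 2`, `G` average-closed): «`\overline{U′U₀}ᵏ` is an analytic function of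
`A′` … `|A′| < α₁`» AND «`|\overline{U′U₀}ᵏ(Ū₀ᵏ)⁻¹ − 1| < O(1)α₁` (164)» under the one threshold `cK d L`, O(1) = 200(d+1).
[cite: Balaban1985Averaging, Proposition 6 (164) p.43] -/
theorem prop6PrintedFull_K (L : ℕ) (hL : 2 ≤ L) (hG : AvgClosed d L G) :
    Prop6PrintedFull (concreteKExpA 𝔸 G (d := d) L) :=
  prop6PrintedFull_of (prop6AnalyticPrinted_K L hL hG) (prop6Printed_KA L hL hG)

end Props

end Literature.MathematicalPhysics.QuantumFieldTheory.Balaban1983to89.B7Prop6FirstClause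

end
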